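import Mathlib
import Literature.MathematicalPhysics.QuantumFieldTheory.Balaban1983to89.B5Prop11Plancherel

/-!
# B5 Prop. 1.1 — pass 5: `G = Δ_a⁻¹` — the algebra (1.71)–(1.83) of [B5, pp. 30–31] in the kernel

B5 = T. Bałaban, *Propagators and renormalization transformations for lattice gauge theories. I*,
Commun. Math. Phys. **95** (1984) 17–40 (`Balaban1984PropagatorsI`).  This module is the fifth
kernel pass on node T02.1 (Prop. 1.1 of B5) of the `pub-balaban` reconstruction.  Passes 2–4
(`B5Prop11Bound`, `B5Prop11Fiber`, `B5Prop11Plancherel`) TYPED the momentum representation (1.83)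
of `G` as the fiber matrices `Fiber.G` / `G₀`, instantiated them on Bałaban's symbols and summed the
fiber bounds into the operator `calG = F^* Ĝ F` on `ℓ²(T_η; ℂ^d)`.  What they did NOT certify is
B5's claim that (1.83) IS the inverse of the operator `Δ_a` of (1.69)/(1.73) — the computation
(1.73) ⟹ (1.75)–(1.82) ⟹ (1.83) printed on pp. 30–31.  This pass certifies exactly that algebra,
fiber by fiber and then at operator level, with zero `sorry`.

## The printed text (verbatim, B5)

* p.22, after (1.25) `Δ²λ − Δ∂*A + Q′*_k ω = 0, … Q′_k λ = 0`: «Hence it is an invertible operator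
  and by Δ⁻¹ we denote its inverse on this subspace. We extend it to the whole space by linearity,
  putting its value on constant functions equal to 0.»
* p.23 (1.29): «f̃(p) = Σ_{x∈T′_η} η^d e^{−ip·x} f(x), p ∈ T̃′_η»; (1.30): «Δ²(p)λ̃(p) − Δ(p)(∂*A)~(p)
  + \overline{u_k(p)} ω̃(p′) = 0, Σ_l u_k(p′+l) λ̃(p′+l) = 0»; (1.31): «Δ(p) = Σ_{μ=1}^d |∂_μ(p)|²,
  ∂_μ(p) = (e^{iηp_μ} − 1)/η, u_k(p) = Π_μ ∂¹_μ(p′)/∂_μ(p)»; «p ∈ T̃_η is represented as a sum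
  p = p′ + l, p′ ∈ T̃₁^{(k)} and l = (l₁,…,l_d), l_μ = 2πm_μ, m_μ is an integer»; «Because u_k(l) = 0
  for l ≠ 0, u_k(0) = 1».
* p.21 (1.21): «⟨∂A, ∂A⟩ = … = Σ_μ ⟨A_μ, ΔA_μ⟩ − ⟨∂*A, ∂*A⟩, where Δ is η-lattice Laplace operator
  for scalar functions and ∂* is the divergence operator for vector functions, ∂*A = Σ_μ ∂*_μ A_μ.»
* p.28 (1.61): «(Q_k A)~_μ(p′) = Σ_l u(p′+l) v_μ(p′+l) Ã_μ(p′+l), v_μ(p) = ∂¹_μ(p′)/∂_μ(p)».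
* p.29 (1.69): «⟨A, Δ_a A⟩ = ⟨A, ∂*∂A⟩ + ⟨A, ∂R∂*A⟩ + a⟨A, Q*QA⟩ = ⟨A, ΔA⟩ − ⟨A, ∂P∂*A⟩ + a⟨A, Q*QA⟩,
  Δ = ∂*∂ + ∂∂*, R = I − P,».
* p.30: «The configuration ∂*A is orthogonal to constant functions and on such configurations the
  operator P is given by the formula P = Δ⁻¹Q′*(Q′Δ⁻²Q′*)⁻¹Q′Δ⁻¹. (1.70) We will obtain an explicit
  representation of Δ_a⁻¹ = G_k, or simply G. (1.71)»; (1.73): «ΔA − ∂Δ⁻¹Q′*(Q′Δ⁻²Q′*)⁻¹Q′Δ⁻¹∂*A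
  + aQ*QA = J has a unique solution for the arbitrary vector function J.»; (1.74): «a⟨1, Q*QA_μ⟩ =
  a⟨1, A_μ⟩ = ⟨1, J_μ⟩, so ⟨1, A_μ⟩ = a⁻¹⟨1, J_μ⟩»; (1.76): «φ = I + aQΔ⁻¹Q*».
* p.31 (1.82): «GJ = GJ′ + a⁻¹J₀. This gives the solution of Eq. (1.73), so G = Δ_a⁻¹. To
  investigate better the operator G we write it in momentum representation: (1.83) … for p′ ≠ 0,
  Ã_μ(l) = (1/Δ(l)) J̃_μ(l), Ã_μ(0) = a⁻¹ J̃_μ(0), where φ_μ(p′) = 1 + aΣ_{l″}|u(p′+l″)|²|v_μ(p′+l″)|²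
  /Δ(p′+l″) for p′ ≠ 0. (1.84)».  ((1.83) itself is quoted in full in `B5Prop11Bound`; its typed form
  is `Fiber.G`, and `G₀` is its `p′ = 0` part.)

## What is typed here (dictionary)

On a fiber `p′ ≠ 0` the modes are `p′ + l`, `l ∈ Λ` (for Bałaban `Λ = (ℤ/n)^d`, `n = L^k`), vector
functions carry the extra index `μ ∈ Fin d`, and the abstract data `F : Fiber Λ d` of pass 2 supply
the printed symbols `Δ(p′+l) = F.Δ l`, `u(p′+l) = F.u l`, `v_μ(p′+l) = F.v μ l`, `∂_μ(p′+l) = F.e μ l`,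
`∂¹_μ(p′) = F.e₁ μ`.  The operators of (1.69)–(1.73) are typed LITERALLY as the fiber matrices given
by their printed momentum representations: `lapS`/`lapV` = multiplication by `Δ(p′+l)` ((1.30)/(1.31);
`Δ = ∂*∂ + ∂∂*` is the scalar Laplacian componentwise on vector functions by (1.21)), `lapSinv` = `Δ⁻¹` (p.22; on a fiber `p′ ≠ 0` no
mode is constant), `dOp` = `∂` with symbol `∂_μ(p)` (1.31), `Qp` = `Q′` with `(Q′λ)~(p′) = Σ_l u(p′+l)
λ̃(p′+l)` (1.30), `Qv` = `Q` (1.61); adjoints `∂*`, `Q′*`, `Q*` are the conjugate transposes (for `Q′*`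
this is the printed term `\overline{u_k(p)} ω̃(p′)` of (1.30); for `Q*` it is confirmed by (1.76)/(1.84)).
Then `Pproj := Δ⁻¹Q′*(Q′Δ⁻²Q′*)⁻¹Q′Δ⁻¹` is (1.70) verbatim (the middle inverse a matrix inverse) and
`Da := Δ − ∂P∂* + aQ*Q` is the fiber of (1.69)/(1.73).  At `p′ = 0`: `Da₀ := Δ + aQ*Q` with `Q`'s
zero fiber `Qv₀` (u(l) = δ_{l0}, p.23; weight of the constant mode fixed by (1.74)); the `P`-term has
no `p′ = 0` component (p.22: `Δ⁻¹ := 0` on constants; p.23: `u_k(l) = 0`, `l ≠ 0`).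

## What is certified (zero `sorry`, axioms `propext`, `Classical.choice`, `Quot.sound`)

* `Pproj_apply`, `dPd_eq`: (1.70) in closed form, `∂P∂* = X⁻¹ q q^*` with `X = Σ_l|u|²/Δ²`,
  `q(l,μ) = ∂_μ conj u/Δ`; `Da_eq`: `Δ_a(p′) = (Δ + aQ*Q) − X⁻¹ q q^*`.
* `Dmat_mul_Omat`: the Sherman–Morrison step `(Δ + aQ*Q)·⊕_μ[Δ⁻¹ − aφ_μ⁻¹x_μx_μ^*] = 1` with
  `φ_μ` = (1.84) — the first two lines of (1.83) invert `Δ + aQ*Q` ((1.75)–(1.81)).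
* `Omat_mulVec_qv`, `star_qv_dot_bv`, `Dmat_mulVec_bv`: the second rank-one step — the square
  bracket `b` of (1.83) is `X⁻¹(Δ + aQ*Q)⁻¹q` and `q^*b = 1 − aΦX`, `Φ = Σ_λ|∂¹_λ|²/φ_λ`.
* `Da_mul_G`, `G_mul_Da`, `G_eq_inv`, `Da_eq_inv`: **`Δ_a(p′) · G(p′) = 1 = G(p′) · Δ_a(p′)` and
  `G(p′) = Δ_a(p′)⁻¹`** for every abstract fiber with `Δ = Σ_μ|∂_μ|²` ((1.31)); for Bałaban's symbols
  this hypothesis is `B5Prop11Fiber.Delta_eq`, whence `Da_mul_G_balaban`, `G_eq_inv_balaban`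
  unconditionally for every `p′ ≠ 0`, `|p′_μ| ≤ π`.
* `Da₀_mul_G₀`: the zero fiber, `(Δ + aQ*Q)G₀ = 1` ((1.74), (1.82), last line of (1.83)).
* `calDa_mul_calG`, `calG_mul_calDa`, `calG_eq_inv`, `calDa_isHermitian`: with `calDa = F^* 𝒟̂_a F`
  the operator on `ℓ²(T_η; ℂ^d)` (`T_η = Π_μ ℤ/(n M_μ)`) whose Fourier blocks over the cosets
  `p = p′ + l` are these fibers, **`𝒟_a 𝒢 = 1 = 𝒢 𝒟_a`, `𝒢 = 𝒟_a⁻¹`** for the operator `𝒢 = calG` of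
  pass 4 — (1.71) at operator level.

## What is NOT certified here (stated, not smuggled)

* That `calDa` IS the lattice operator `Δ − ∂P∂* + aQ*Q` of (1.69) acting on `A : T_η → ℂ^d`: this
  requires the position-space definitions of `Q_k`, `Q′_k` (block averages: (1.18) p.20 and the
  display after (1.20), p.20) and the derivation of their symbols (1.30)/(1.61) by geometric sums, the
  derivation of the symbol (1.31) of the scalar `η`-lattice Laplacian from (1.29) (that `Δ = ∂*∂ + ∂∂*`
  of (1.69) acts componentwise as the scalar Laplacian IS printed: (1.21) p.21), and the
  identification of `P` with the orthogonal projection of (1.69); we take the printed momentum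
  representations as the definitions (dictionary above).  In particular the vanishing of the `p′ = 0` component of
  `∂P∂*A` is a reading of p.22/p.23, not a kernel fact about lattice operators.
* (1.90) (the bound `|G(x,x′)| ≤ C e^{−δ|x−x′|}` of Prop. 1.1) and positivity `Δ_a ≥ γ₀(Δ + I)`:
  untouched (pass 4 certified only the uniform operator-norm bounds of `𝒢`, `∇𝒢`, `∇𝒢∇^*`).
* Torus sizes / parity conventions (`L` odd vs even, `valMinAbs` representatives) as recorded in
  `B5Prop11Plancherel`; uniqueness in (1.73) is equivalent to invertibility, which is what is proved.

Value: a kernel certificate of the linear algebra (1.73) ⟹ (1.83) ("so G = Δ_a⁻¹"), NOT summit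
progress.
-/

open scoped BigOperators Matrix ComplexConjugate
open Finset Complex

namespace Literature.MathematicalPhysics.QuantumFieldTheory.Balaban1983to89.B5Prop11Inverse

open Literature.MathematicalPhysics.QuantumFieldTheory.Balaban1983to89.B4Strip
open Literature.MathematicalPhysics.QuantumFieldTheory.Balaban1983to89.B5Prop11Leaves
open Literature.MathematicalPhysics.QuantumFieldTheory.Balaban1983to89.B5Prop11Bound
open Literature.MathematicalPhysics.QuantumFieldTheory.Balaban1983to89.B5Prop11Fiber
open Literature.MathematicalPhysics.QuantumFieldTheory.Balaban1983to89.B5Prop11Plancherel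

noncomputable section

/-! ## §1 The fiber of `Δ_a` built from the printed momentum representations -/

section Abstract

variable {Λ : Type*} [Fintype Λ] [DecidableEq Λ] {d : ℕ} (F : Fiber Λ d)

/-- `Δ` on scalar functions: multiplication by `Δ(p′ + l)` ((1.25) ↔ (1.30), (1.31)).
[cite: Balaban1984PropagatorsI, (1.30)-(1.31) p.23] -/
def lapS : Matrix Λ Λ ℂ := Matrix.diagonal fun l => (F.Δ l : ℂ)

/-- `Δ⁻¹` on the fiber `p′ ≠ 0` (every mode `p′ + l` is non-constant, p.22): `1/Δ(p′ + l)`.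
[cite: Balaban1984PropagatorsI, p.22 (the operator Δ⁻¹)] -/
def lapSinv : Matrix Λ Λ ℂ := Matrix.diagonal fun l => 1 / (F.Δ l : ℂ)

/-- `Δ = ∂*∂ + ∂∂*` on vector functions ((1.69)) is the scalar `η`-lattice Laplacian componentwise
((1.21): `⟨∂A, ∂A⟩ = Σ_μ⟨A_μ, ΔA_μ⟩ − ⟨∂*A, ∂*A⟩`): multiplication by `Δ(p′ + l)` (1.31).
[cite: Balaban1984PropagatorsI, (1.21) p.21, (1.69) p.29, (1.31) p.23] -/
def lapV : Matrix (Λ × Fin d) (Λ × Fin d) ℂ := Matrix.diagonal fun i => (F.Δ i.1 : ℂ)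

/-- `∂` (scalar → vector functions): `(∂λ)~_μ(p) = ∂_μ(p) λ̃(p)` with `∂_μ(p)` of (1.31).
[cite: Balaban1984PropagatorsI, (1.31) p.23] -/
def dOp : Matrix (Λ × Fin d) Λ ℂ := fun i l => if i.1 = l then F.e i.2 l else 0

/-- `Q′ = Q′_k` (scalar functions on `T_η` → scalar functions on the unit lattice):
`(Q′λ)~(p′) = Σ_l u_k(p′ + l) λ̃(p′ + l)` ((1.25) ↔ (1.30)); the unit-lattice momentum `p′` is
fixed on a fiber, so the target index is a single point. [cite: Balaban1984PropagatorsI, (1.30) p.23] -/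
def Qp : Matrix Unit Λ ℂ := fun _ l => F.u l

/-- `Q = Q_k` (vector functions): `(Q_k A)~_μ(p′) = Σ_l u(p′ + l) v_μ(p′ + l) Ã_μ(p′ + l)` (1.61).
[cite: Balaban1984PropagatorsI, (1.61) p.28] -/
def Qv : Matrix (Fin d) (Λ × Fin d) ℂ := fun μ i => if i.2 = μ then F.u i.1 * F.v μ i.1 else 0

/-- (1.70): `P = Δ⁻¹ Q′* (Q′ Δ⁻² Q′*)⁻¹ Q′ Δ⁻¹`, literally, on the fiber (adjoints = conjugate
transposes, `Δ⁻² = Δ⁻¹Δ⁻¹`, the middle inverse a matrix inverse).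
[cite: Balaban1984PropagatorsI, (1.70) p.30] -/
def Pproj : Matrix Λ Λ ℂ :=
  lapSinv F * (Qp F)ᴴ * (Qp F * lapSinv F * lapSinv F * (Qp F)ᴴ)⁻¹ * Qp F * lapSinv F

/-- (1.69)/(1.73): THE FIBER OF `Δ_a = Δ − ∂P∂* + aQ*Q` at `p′ ≠ 0`.
[cite: Balaban1984PropagatorsI, (1.69) p.29, (1.73) p.30] -/
def Da : Matrix (Λ × Fin d) (Λ × Fin d) ℂ :=
  lapV F - dOp F * Pproj F * (dOp F)ᴴ + (F.a : ℂ) • ((Qv F)ᴴ * Qv F)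

/-! ### closed forms -/

/-- `q(l, μ) = ∂_μ(p′+l) conj u(p′+l) / Δ(p′+l)` (the vector with `∂P∂* = X⁻¹ q q^*`). [folklore] -/
def qv : Λ × Fin d → ℂ := fun i => F.e i.2 i.1 * conj (F.u i.1) / (F.Δ i.1 : ℂ)

/-- `c_μ(l) = conj (u(p′+l) v_μ(p′+l))` (the vector with `(Q*Q)_μ = c_μ c_μ^*`). [folklore] -/
def cv (μ : Fin d) (l : Λ) : ℂ := conj (F.u l * F.v μ l)

/-- `D = Δ + aQ*Q` on the fiber: block-diagonal in `μ`, blocks `diag Δ + a c_μ c_μ^*`. [folklore] -/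
def Dmat : Matrix (Λ × Fin d) (Λ × Fin d) ℂ := fun i j =>
  if i.2 = j.2 then
    (if i.1 = j.1 then (F.Δ i.1 : ℂ) else 0) + (F.a : ℂ) * cv F i.2 i.1 * conj (cv F i.2 j.1)
  else 0

/-- `O = ⊕_μ [Δ⁻¹ − a φ_μ⁻¹ x_μ x_μ^*]`: the first two lines of (1.83).
[cite: Balaban1984PropagatorsI, (1.83) p.31] -/
def Omat : Matrix (Λ × Fin d) (Λ × Fin d) ℂ := fun i j =>
  if i.2 = j.2 then
    (if i.1 = j.1 then 1 / (F.Δ i.1 : ℂ) else 0) - (F.a : ℂ) / (F.φ i.2 : ℂ) * F.x i.2 i.1 * conj (F.x i.2 j.1)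
  else 0

/-- the square bracket of (1.83) as a vector indexed by `(l, μ)`. [cite: Balaban1984PropagatorsI, (1.83) p.31] -/
def bv : Λ × Fin d → ℂ := fun i => F.b i.1 i.2

/-- (1.83) = `O + a⁻¹Φ⁻¹ b b^*`. [cite: Balaban1984PropagatorsI, (1.83) p.31] -/
theorem G_eq : F.G = Omat F + F.cT • Matrix.vecMulVec (bv F) (star (bv F)) := by
  ext i j
  simp only [Fiber.G, Omat, bv, Matrix.add_apply, Matrix.smul_apply, Matrix.vecMulVec_apply,
    Pi.star_apply, Complex.star_def, smul_eq_mul]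
  ring

/-- `Δ⁻¹ Q′*` on the fiber: the column `conj u(p′+l)/Δ(p′+l)`. [folklore] -/
theorem lapSinv_mul_QpH :
    lapSinv F * (Qp F)ᴴ = Matrix.of fun l (_ : Unit) => conj (F.u l) / (F.Δ l : ℂ) := by
  ext l k
  simp [lapSinv, Qp, Matrix.diagonal_mul, div_eq_inv_mul]

/-- `Q′ Δ⁻¹` on the fiber: the row `u(p′+l)/Δ(p′+l)`. [folklore] -/
theorem Qp_mul_lapSinv :
    Qp F * lapSinv F = Matrix.of fun (_ : Unit) l => F.u l / (F.Δ l : ℂ) := by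
  ext k l
  simp [lapSinv, Qp, Matrix.mul_diagonal, div_eq_mul_inv]

/-- `Q′ Δ⁻²` on the fiber: the row `u(p′+l)/Δ²(p′+l)`. [folklore] -/
theorem Qp_mul_lapSinv_sq :
    Qp F * lapSinv F * lapSinv F = Matrix.of fun (_ : Unit) l => F.u l / (F.Δ l : ℂ) ^ 2 := by
  rw [Qp_mul_lapSinv]
  ext k l
  simp [lapSinv, Matrix.mul_diagonal, div_eq_mul_inv, sq, mul_assoc]

/-- `Q′ Δ⁻² Q′* = X(p′)` on the fiber (`X = Σ_l |u(p′+l)|²/Δ²(p′+l)`, the sum inverted in (1.70)/(1.83)).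
[cite: Balaban1984PropagatorsI, (1.70) p.30, (1.83) p.31] -/
theorem Qp_lapSinv_sq_Qp :
    Qp F * lapSinv F * lapSinv F * (Qp F)ᴴ = (F.X : ℂ) • (1 : Matrix Unit Unit ℂ) := by
  rw [Qp_mul_lapSinv_sq]
  ext i j
  simp only [Matrix.mul_apply, Matrix.of_apply, Qp, Matrix.conjTranspose_apply, Complex.star_def,
    Matrix.smul_apply, Matrix.one_apply_eq, smul_eq_mul, mul_one]
  rw [Fiber.X]
  push_cast
  refine Finset.sum_congr rfl fun l _ => ?_
  have h := Complex.mul_conj' (F.u l)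
  have hΔ : (F.Δ l : ℂ) ≠ 0 := by exact_mod_cast (F.Δ_pos l).ne'
  field_simp
  linear_combination h

/-- the inverse of the `1 × 1` matrix `Q′ Δ⁻² Q′*`. [folklore] -/
theorem inv_Qp_lapSinv_sq_Qp :
    (Qp F * lapSinv F * lapSinv F * (Qp F)ᴴ)⁻¹ = (1 / (F.X : ℂ)) • (1 : Matrix Unit Unit ℂ) := by
  rw [Qp_lapSinv_sq_Qp]
  have hX : (F.X : ℂ) ≠ 0 := by exact_mod_cast F.X_pos.ne'
  apply Matrix.inv_eq_right_inv
  rw [Matrix.smul_mul, Matrix.mul_smul, Matrix.one_mul, smul_smul]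
  rw [show (F.X : ℂ) * (1 / (F.X : ℂ)) = 1 by field_simp, one_smul]

/-- (1.70) in closed form: `P(l, l′) = conj u(p′+l) u(p′+l′) / (Δ(p′+l) X(p′) Δ(p′+l′))`.
[cite: Balaban1984PropagatorsI, (1.70) p.30] -/
theorem Pproj_apply (l l' : Λ) :
    Pproj F l l' = conj (F.u l) * F.u l' / ((F.Δ l : ℂ) * (F.X : ℂ) * (F.Δ l' : ℂ)) := by
  rw [Pproj, inv_Qp_lapSinv_sq_Qp, lapSinv_mul_QpH, Matrix.mul_assoc _ (Qp F), Qp_mul_lapSinv]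
  simp only [Matrix.mul_apply, Matrix.of_apply, Matrix.smul_apply, Matrix.one_apply_eq,
    smul_eq_mul, mul_one, Finset.univ_unique, Finset.sum_singleton]
  have hΔ : (F.Δ l : ℂ) ≠ 0 := by exact_mod_cast (F.Δ_pos l).ne'
  have hΔ' : (F.Δ l' : ℂ) ≠ 0 := by exact_mod_cast (F.Δ_pos l').ne'
  have hX : (F.X : ℂ) ≠ 0 := by exact_mod_cast F.X_pos.ne'
  field_simp

/-- `∂P∂* = X⁻¹ q q^*` on the fiber. [folklore] -/
theorem dPd_eq :
    dOp F * Pproj F * (dOp F)ᴴ = (1 / (F.X : ℂ)) • Matrix.vecMulVec (qv F) (star (qv F)) := by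
  ext i j
  simp only [Matrix.mul_apply, dOp, Pproj_apply, Matrix.conjTranspose_apply, Complex.star_def,
    Matrix.smul_apply, Matrix.vecMulVec_apply, Pi.star_apply, qv, smul_eq_mul, ite_mul, zero_mul,
    Finset.sum_ite_eq, Finset.mem_univ, if_true, apply_ite conj, map_zero, mul_ite, mul_zero,
    map_mul, map_div₀, Complex.conj_conj, Complex.conj_ofReal]
  have hΔ : (F.Δ i.1 : ℂ) ≠ 0 := by exact_mod_cast (F.Δ_pos i.1).ne'
  have hΔ' : (F.Δ j.1 : ℂ) ≠ 0 := by exact_mod_cast (F.Δ_pos j.1).ne'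
  have hX : (F.X : ℂ) ≠ 0 := by exact_mod_cast F.X_pos.ne'
  field_simp

/-- `Q*Q` on the fiber: `δ_{μν} conj(u v_μ)(p′+l) (u v_μ)(p′+l′)`. [folklore] -/
theorem QQ_apply (i j : Λ × Fin d) :
    ((Qv F)ᴴ * Qv F) i j = if i.2 = j.2 then cv F i.2 i.1 * conj (cv F i.2 j.1) else 0 := by
  simp only [Matrix.mul_apply, Qv, Matrix.conjTranspose_apply, Complex.star_def, cv,
    apply_ite conj, map_zero, map_mul, Complex.conj_conj, ite_mul, zero_mul, mul_ite, mul_zero]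
  by_cases h : i.2 = j.2
  · rw [Finset.sum_eq_single i.2]
    · simp [h]
    · intro μ _ hμ
      simp [Ne.symm hμ]
    · simp
  · rw [if_neg h]
    refine Finset.sum_eq_zero fun μ _ => ?_
    by_cases h1 : i.2 = μ
    · have h2 : ¬ (j.2 = μ) := fun h' => h (h1.trans h'.symm)
      simp [h2]
    · simp [h1]

/-- `Δ_a(p′) = D − X⁻¹ q q^*` with `D = Δ + aQ*Q`. [folklore] -/
theorem Da_eq : Da F = Dmat F - (1 / (F.X : ℂ)) • Matrix.vecMulVec (qv F) (star (qv F)) := by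
  rw [Da, dPd_eq]
  ext i j
  simp only [Matrix.add_apply, Matrix.sub_apply, Matrix.smul_apply, lapV, Matrix.diagonal_apply,
    QQ_apply, Dmat, smul_eq_mul]
  by_cases h2 : i.2 = j.2
  · by_cases h1 : i.1 = j.1
    · have hij : i = j := Prod.ext h1 h2
      subst hij
      simp
      ring
    · have hij : i ≠ j := fun h => h1 (congrArg Prod.fst h)
      simp [h1, h2, hij]
      ring
  · have hij : i ≠ j := fun h => h2 (congrArg Prod.snd h)
    simp [h2, hij]

/-! ## §2 Complex forms of the printed sums -/

/-- `X(p′) = Σ_l u conj u / Δ²` in `ℂ`. [folklore] -/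
theorem X_cast : (F.X : ℂ) = ∑ l, F.u l * conj (F.u l) / (F.Δ l : ℂ) ^ 2 := by
  rw [Fiber.X]
  push_cast
  refine Finset.sum_congr rfl fun l _ => ?_
  rw [Complex.mul_conj']

/-- (1.84) in `ℂ`: `φ_μ(p′) = 1 + a Σ_l (u v_μ) conj(u v_μ) / Δ`. [cite: Balaban1984PropagatorsI, (1.84) p.31] -/
theorem φ_cast (μ : Fin d) :
    (F.φ μ : ℂ) = 1 + (F.a : ℂ) * ∑ l, (F.u l * F.v μ l) * conj (F.u l * F.v μ l) / (F.Δ l : ℂ) := by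
  rw [Fiber.φ]
  push_cast
  congr 1
  congr 1
  refine Finset.sum_congr rfl fun l _ => ?_
  rw [Complex.mul_conj']

/-- `Φ(p′) = Σ_λ ∂_{1,λ} conj ∂_{1,λ} / φ_λ` in `ℂ`. [folklore] -/
theorem Φ_cast : (F.Φ : ℂ) = ∑ μ, F.e₁ μ * conj (F.e₁ μ) / (F.φ μ : ℂ) := by
  rw [Fiber.Φ]
  push_cast
  refine Finset.sum_congr rfl fun μ _ => ?_
  rw [Complex.mul_conj']

/-- (1.31) `Δ(p) = Σ_μ |∂_μ(p)|²` in `ℂ` (the hypothesis `hΔe`). [cite: Balaban1984PropagatorsI, (1.31) p.23] -/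
theorem Δ_cast (hΔe : ∀ l, F.Δ l = ∑ μ, ‖F.e μ l‖ ^ 2) (l : Λ) :
    (F.Δ l : ℂ) = ∑ μ, F.e μ l * conj (F.e μ l) := by
  rw [hΔe l]
  push_cast
  refine Finset.sum_congr rfl fun μ _ => ?_
  rw [Complex.mul_conj']

/-- `x_μ(l) = c_μ(l) / Δ(p′+l)`. [folklore] -/
theorem x_eq (μ : Fin d) (l : Λ) : F.x μ l = cv F μ l / (F.Δ l : ℂ) := rfl

/-- `Σ_l conj c_μ(l) x_μ(l) = (φ_μ − 1)/a`. [folklore] -/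
theorem star_cv_dot_x (μ : Fin d) :
    star (cv F μ) ⬝ᵥ F.x μ = ((F.φ μ : ℂ) - 1) / (F.a : ℂ) := by
  have ha : (F.a : ℂ) ≠ 0 := by exact_mod_cast F.a_pos.ne'
  rw [eq_div_iff ha, φ_cast, dotProduct]
  simp only [Pi.star_apply, Complex.star_def, x_eq, cv, Complex.conj_conj]
  rw [add_sub_cancel_left, Finset.mul_sum, Finset.sum_mul]
  refine Finset.sum_congr rfl fun l _ => ?_
  ring

/-! ## §3 Sherman–Morrison for `D = Δ + aQ*Q` -/

/-- block of `D = Δ + aQ*Q` at component `μ`: `diag Δ + a c_μ c_μ^*`. [folklore] -/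
def Dblk (μ : Fin d) : Matrix Λ Λ ℂ :=
  Matrix.diagonal (fun l => (F.Δ l : ℂ)) + (F.a : ℂ) • Matrix.vecMulVec (cv F μ) (star (cv F μ))

/-- block of `O` at component `μ`: `diag Δ⁻¹ − a φ_μ⁻¹ x_μ x_μ^*`. [folklore] -/
def Oblk (μ : Fin d) : Matrix Λ Λ ℂ :=
  Matrix.diagonal (fun l => 1 / (F.Δ l : ℂ))
    - ((F.a : ℂ) / (F.φ μ : ℂ)) • Matrix.vecMulVec (F.x μ) (star (F.x μ))

/-- `D` is block-diagonal in the component index. [folklore] -/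
theorem Dmat_eq_blockDiagonal : Dmat F = Matrix.blockDiagonal (Dblk F) := by
  ext i j
  simp only [Dmat, Matrix.blockDiagonal_apply, Dblk, Matrix.add_apply, Matrix.diagonal_apply,
    Matrix.smul_apply, Matrix.vecMulVec_apply, Pi.star_apply, Complex.star_def, smul_eq_mul]
  split_ifs <;> ring

/-- `O` is block-diagonal in the component index. [folklore] -/
theorem Omat_eq_blockDiagonal : Omat F = Matrix.blockDiagonal (Oblk F) := by
  ext i j
  simp only [Omat, Matrix.blockDiagonal_apply, Oblk, Matrix.sub_apply, Matrix.diagonal_apply,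
    Matrix.smul_apply, Matrix.vecMulVec_apply, Pi.star_apply, Complex.star_def, smul_eq_mul]
  split_ifs <;> ring

/-- the Sherman–Morrison identity per component:
`(diag Δ + a c c^*)(diag Δ⁻¹ − aφ⁻¹ x x^*) = 1` with `x = c/Δ`, `φ = 1 + a c^*x`. [folklore] -/
theorem Dblk_mul_Oblk (μ : Fin d) : Dblk F μ * Oblk F μ = 1 := by
  have ha : (F.a : ℂ) ≠ 0 := by exact_mod_cast F.a_pos.ne'
  have hφ : (F.φ μ : ℂ) ≠ 0 := by exact_mod_cast (F.φ_pos μ).ne'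
  have hΔ : ∀ l, (F.Δ l : ℂ) ≠ 0 := fun l => by exact_mod_cast (F.Δ_pos l).ne'
  have h1 : Matrix.diagonal (fun l => (F.Δ l : ℂ)) * Matrix.diagonal (fun l => 1 / (F.Δ l : ℂ))
      = 1 := by
    rw [Matrix.diagonal_mul_diagonal, ← Matrix.diagonal_one]
    congr 1
    funext l
    field_simp [hΔ l]
  have h2 : Matrix.diagonal (fun l => (F.Δ l : ℂ)) * Matrix.vecMulVec (F.x μ) (star (F.x μ))
      = Matrix.vecMulVec (cv F μ) (star (F.x μ)) := by
    rw [Matrix.mul_vecMulVec]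
    congr 1
    funext l
    rw [Matrix.mulVec_diagonal, x_eq]
    field_simp [hΔ l]
  have h3 : Matrix.vecMulVec (cv F μ) (star (cv F μ)) * Matrix.diagonal (fun l => 1 / (F.Δ l : ℂ))
      = Matrix.vecMulVec (cv F μ) (star (F.x μ)) := by
    rw [Matrix.vecMulVec_mul]
    congr 1
    funext l
    rw [Matrix.vecMul_diagonal, Pi.star_apply, Pi.star_apply, x_eq]
    simp only [Complex.star_def, map_div₀, Complex.conj_ofReal]
    field_simp
  have h4 : Matrix.vecMulVec (cv F μ) (star (cv F μ)) * Matrix.vecMulVec (F.x μ) (star (F.x μ))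
      = (((F.φ μ : ℂ) - 1) / (F.a : ℂ)) • Matrix.vecMulVec (cv F μ) (star (F.x μ)) := by
    rw [Matrix.vecMulVec_mul_vecMulVec, star_cv_dot_x, Matrix.vecMulVec_smul]
  rw [Dblk, Oblk, Matrix.add_mul, Matrix.mul_sub, Matrix.mul_sub, Matrix.mul_smul, Matrix.smul_mul,
    Matrix.smul_mul, Matrix.mul_smul, h1, h2, h3, h4, smul_smul]
  ext i j
  simp only [Matrix.add_apply, Matrix.sub_apply, Matrix.smul_apply, smul_eq_mul]
  field_simp
  ring

/-- `(Δ + aQ*Q) · O = 1` on the fiber. [folklore] -/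
theorem Dmat_mul_Omat : Dmat F * Omat F = 1 := by
  rw [Dmat_eq_blockDiagonal, Omat_eq_blockDiagonal, ← Matrix.blockDiagonal_mul]
  have h : (fun k => Dblk F k * Oblk F k) = 1 := funext fun k => Dblk_mul_Oblk F k
  rw [h, Matrix.blockDiagonal_one]

/-- `O` is Hermitian. [folklore] -/
theorem Omat_conjTranspose : (Omat F)ᴴ = Omat F := by
  ext i j
  simp only [Omat, Matrix.conjTranspose_apply, Complex.star_def]
  by_cases h2 : i.2 = j.2
  · by_cases h1 : i.1 = j.1
    · have hij : j = i := (Prod.ext h1 h2).symm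
      subst hij
      simp only [if_true, map_sub, map_div₀, map_one, Complex.conj_ofReal, map_mul,
        Complex.conj_conj]
      ring
    · rw [if_pos h2, if_pos h2.symm, if_neg h1, if_neg (Ne.symm h1)]
      simp only [map_sub, map_zero, map_mul, map_div₀, Complex.conj_ofReal, Complex.conj_conj, h2]
      ring
  · rw [if_neg h2, if_neg (Ne.symm h2), map_zero]

/-! ## §4 The projection term against `O`: `O q = X b`, `q^* b = 1 − aΦX` -/

/-- `Σ_l conj x_μ(l) q(l, μ) = ∂_{1,μ}(p′) X(p′)` (uses E1: `∂¹ = v ∂`). [folklore] -/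
theorem sum_conj_x_mul_qv (μ : Fin d) :
    ∑ l, conj (F.x μ l) * qv F (l, μ) = F.e₁ μ * (F.X : ℂ) := by
  rw [X_cast, Finset.mul_sum]
  refine Finset.sum_congr rfl fun l _ => ?_
  have hΔ : (F.Δ l : ℂ) ≠ 0 := by exact_mod_cast (F.Δ_pos l).ne'
  simp only [Fiber.x, qv, map_div₀, map_mul, Complex.conj_conj, Complex.conj_ofReal]
  rw [F.e₁_eq μ l]
  field_simp

/-- `O q = X b`: the bracket `[…]` of (1.83) is `X⁻¹ O q`. [folklore] -/
theorem Omat_mulVec_qv : Matrix.mulVec (Omat F) (qv F) = (F.X : ℂ) • bv F := by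
  funext i
  have hΔ : (F.Δ i.1 : ℂ) ≠ 0 := by exact_mod_cast (F.Δ_pos i.1).ne'
  have hφ : (F.φ i.2 : ℂ) ≠ 0 := by exact_mod_cast (F.φ_pos i.2).ne'
  have hX : (F.X : ℂ) ≠ 0 := by exact_mod_cast F.X_pos.ne'
  have hsum : ∑ l, (F.a : ℂ) / (F.φ i.2 : ℂ) * F.x i.2 i.1 * conj (F.x i.2 l) * qv F (l, i.2)
      = (F.a : ℂ) / (F.φ i.2 : ℂ) * F.x i.2 i.1 * (F.e₁ i.2 * (F.X : ℂ)) := by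
    rw [← sum_conj_x_mul_qv, Finset.mul_sum]
    refine Finset.sum_congr rfl fun l _ => ?_
    ring
  rw [Matrix.mulVec, dotProduct, Fintype.sum_prod_type]
  have hinner : ∀ l : Λ, ∑ μ : Fin d, Omat F i (l, μ) * qv F (l, μ)
      = ((if i.1 = l then 1 / (F.Δ i.1 : ℂ) else 0)
          - (F.a : ℂ) / (F.φ i.2 : ℂ) * F.x i.2 i.1 * conj (F.x i.2 l)) * qv F (l, i.2) := by
    intro l
    have : ∀ μ : Fin d, Omat F i (l, μ) * qv F (l, μ)
        = if i.2 = μ then ((if i.1 = l then 1 / (F.Δ i.1 : ℂ) else 0)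
          - (F.a : ℂ) / (F.φ i.2 : ℂ) * F.x i.2 i.1 * conj (F.x i.2 l)) * qv F (l, μ) else 0 := by
      intro μ
      by_cases h : i.2 = μ
      · subst h
        simp [Omat]
      · simp [Omat, h]
    rw [Finset.sum_congr rfl fun μ _ => this μ, Finset.sum_ite_eq]
    simp
  simp_rw [hinner, sub_mul, Finset.sum_sub_distrib, ite_mul, zero_mul, Finset.sum_ite_eq,
    Finset.mem_univ, if_true, hsum]
  simp only [Pi.smul_apply, smul_eq_mul, bv, Fiber.b, qv, Fiber.x]
  field_simp

/-- `q^* O = X b^*`. [folklore] -/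
theorem star_qv_vecMul_Omat : Matrix.vecMul (star (qv F)) (Omat F) = (F.X : ℂ) • star (bv F) := by
  have h := Omat_mulVec_qv F
  rw [← Omat_conjTranspose, ← Matrix.star_mulVec, h, star_smul, Complex.star_def,
    Complex.conj_ofReal]

/-- `q^* b = 1 − a Φ X` (uses `Δ = Σ_μ|∂_μ|²` and E1). [folklore] -/
theorem star_qv_dot_bv (hΔe : ∀ l, F.Δ l = ∑ μ, ‖F.e μ l‖ ^ 2) :
    star (qv F) ⬝ᵥ bv F = 1 - (F.a : ℂ) * (F.Φ : ℂ) * (F.X : ℂ) := by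
  have hX : (F.X : ℂ) ≠ 0 := by exact_mod_cast F.X_pos.ne'
  have hφ : ∀ μ, (F.φ μ : ℂ) ≠ 0 := fun μ => by exact_mod_cast (F.φ_pos μ).ne'
  have hΔ : ∀ l, (F.Δ l : ℂ) ≠ 0 := fun l => by exact_mod_cast (F.Δ_pos l).ne'
  have per_l : ∀ l : Λ, ∑ μ : Fin d, conj (qv F (l, μ)) * bv F (l, μ)
      = F.u l * conj (F.u l) / (F.Δ l : ℂ) ^ 2 * (1 / (F.X : ℂ) - (F.a : ℂ) * (F.Φ : ℂ)) := by
    intro l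
    have hterm : ∀ μ : Fin d, conj (qv F (l, μ)) * bv F (l, μ)
        = F.u l * conj (F.u l) / ((F.Δ l : ℂ) ^ 3 * (F.X : ℂ)) * (F.e μ l * conj (F.e μ l))
          - (F.a : ℂ) * (F.u l * conj (F.u l)) / (F.Δ l : ℂ) ^ 2
            * (F.e₁ μ * conj (F.e₁ μ) / (F.φ μ : ℂ)) := by
      intro μ
      simp only [qv, bv, Fiber.b, map_mul, map_div₀, Complex.conj_conj, Complex.conj_ofReal]
      rw [F.e₁_eq μ l, map_mul]
      field_simp
    rw [Finset.sum_congr rfl fun μ _ => hterm μ, Finset.sum_sub_distrib, ← Finset.mul_sum,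
      ← Finset.mul_sum, ← Δ_cast F hΔe l, ← Φ_cast]
    field_simp
  rw [dotProduct, Fintype.sum_prod_type]
  simp only [Pi.star_apply, Complex.star_def]
  rw [Finset.sum_congr rfl fun l _ => per_l l, ← Finset.sum_mul, ← X_cast]
  field_simp

/-! ## §5 `Δ_a(p′) · G(p′) = 1 = G(p′) · Δ_a(p′)` -/

/-- `D b = X⁻¹ q`. [folklore] -/
theorem Dmat_mulVec_bv : Matrix.mulVec (Dmat F) (bv F) = (1 / (F.X : ℂ)) • qv F := by
  have hX : (F.X : ℂ) ≠ 0 := by exact_mod_cast F.X_pos.ne'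
  have h : Matrix.mulVec (Dmat F) (Matrix.mulVec (Omat F) (qv F)) = qv F := by
    rw [Matrix.mulVec_mulVec, Dmat_mul_Omat, Matrix.one_mulVec]
  rw [Omat_mulVec_qv, Matrix.mulVec_smul] at h
  rw [← h, smul_smul, show (1 / (F.X : ℂ)) * (F.X : ℂ) = 1 by field_simp, one_smul]

/-- (1.73) ⟹ (1.83): `Δ_a(p′) G(p′) = 1` for every fiber `p′ ≠ 0` of the abstract data
satisfying `Δ = Σ_μ |∂_μ|²`. [cite: Balaban1984PropagatorsI, (1.73) p.30, (1.81)-(1.83) p.31 (proof ours)] -/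
theorem Da_mul_G (hΔe : ∀ l, F.Δ l = ∑ μ, ‖F.e μ l‖ ^ 2) : Da F * F.G = 1 := by
  have hX : (F.X : ℂ) ≠ 0 := by exact_mod_cast F.X_pos.ne'
  have hΦ : (F.Φ : ℂ) ≠ 0 := by exact_mod_cast F.Φ_pos.ne'
  have ha : (F.a : ℂ) ≠ 0 := by exact_mod_cast F.a_pos.ne'
  rw [Da_eq, G_eq, Matrix.sub_mul, Matrix.mul_add, Matrix.mul_add, Matrix.mul_smul,
    Matrix.smul_mul, Matrix.smul_mul, Matrix.mul_smul, Dmat_mul_Omat, Matrix.mul_vecMulVec,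
    Dmat_mulVec_bv, Matrix.vecMulVec_mul, star_qv_vecMul_Omat, Matrix.vecMulVec_mul_vecMulVec,
    star_qv_dot_bv F hΔe, Matrix.smul_vecMulVec, Matrix.vecMulVec_smul, Matrix.vecMulVec_smul,
    smul_smul, smul_smul]
  ext i j
  simp only [Matrix.add_apply, Matrix.sub_apply, Matrix.smul_apply, smul_eq_mul, Fiber.cT]
  field_simp
  ring

/-- `G(p′) Δ_a(p′) = 1`. [cite: Balaban1984PropagatorsI, (1.71) p.30 (proof ours)] -/
theorem G_mul_Da (hΔe : ∀ l, F.Δ l = ∑ μ, ‖F.e μ l‖ ^ 2) : F.G * Da F = 1 :=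
  mul_eq_one_comm.mp (Da_mul_G F hΔe)

/-- (1.71) `Δ_a⁻¹ = G` on the fiber: the typed (1.83) IS the inverse matrix of the typed (1.73).
[cite: Balaban1984PropagatorsI, (1.71) p.30, (1.83) p.31 (proof ours)] -/
theorem G_eq_inv (hΔe : ∀ l, F.Δ l = ∑ μ, ‖F.e μ l‖ ^ 2) : F.G = (Da F)⁻¹ :=
  (Matrix.inv_eq_right_inv (Da_mul_G F hΔe)).symm

/-- and conversely `Δ_a(p′) = G(p′)⁻¹`. [cite: Balaban1984PropagatorsI, (1.71) p.30 (proof ours)] -/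
theorem Da_eq_inv (hΔe : ∀ l, F.Δ l = ∑ μ, ‖F.e μ l‖ ^ 2) : Da F = F.G⁻¹ :=
  (Matrix.inv_eq_right_inv (G_mul_Da F hΔe)).symm

end Abstract

/-! ## §6 The fiber `p′ = 0` -/

section Zero

variable {Λ : Type*} [Fintype Λ] [DecidableEq Λ] {d : ℕ}

/-- `Q = Q_k` (1.61) on the fiber `p′ = 0`: `(QA)~_μ(0) = Σ_l u(l) v_μ(l) Ã_μ(l) = Ã_μ(0)`, since
`u_k(l) = 0` for `l ≠ 0`, `u_k(0) = 1` (p.23) and `⟨1, Q*QA_μ⟩ = ⟨1, A_μ⟩` (1.74) fixes the weight of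
the constant mode to `1`. [cite: Balaban1984PropagatorsI, p.23 (after (1.31)), (1.74) p.30] -/
def Qv₀ (o : Λ) : Matrix (Fin d) (Λ × Fin d) ℂ := fun μ i => if i = (o, μ) then 1 else 0

/-- (1.73) on the fiber `p′ = 0`: `Δ + aQ*Q` (`Δ = diag Δ(l)`, (1.31), with `Δ(0) = 0`); the term
`∂Δ⁻¹Q′*(Q′Δ⁻²Q′*)⁻¹Q′Δ⁻¹∂*A` has no `p′ = 0` component: `(Q′*Y)~(l) = conj u_k(l) Ỹ(0)` vanishes
for `l ≠ 0` (p.23) and `Δ⁻¹` is `0` on the constant mode `l = 0` (p.22: "putting its value on constant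
functions equal to 0"). [cite: Balaban1984PropagatorsI, (1.73)-(1.74) p.30, p.22, p.23] -/
def Da₀ (o : Λ) (a : ℝ) (Δ : Λ → ℝ) : Matrix (Λ × Fin d) (Λ × Fin d) ℂ :=
  Matrix.diagonal (fun i => (Δ i.1 : ℂ)) + (a : ℂ) • ((Qv₀ (d := d) o)ᴴ * Qv₀ (d := d) o)

omit [Fintype Λ] in
/-- `Q*Q` at `p′ = 0` is the projection onto the constant modes `(0, μ)`. [folklore] -/
theorem Qv₀H_mul_Qv₀ (o : Λ) :
    (Qv₀ (d := d) o)ᴴ * Qv₀ (d := d) o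
      = Matrix.diagonal (fun i : Λ × Fin d => if i.1 = o then (1 : ℂ) else 0) := by
  ext i j
  rw [Matrix.mul_apply, Matrix.diagonal_apply]
  by_cases hij : i = j
  · subst hij
    rw [if_pos rfl]
    by_cases hi : i.1 = o
    · rw [if_pos hi, Finset.sum_eq_single i.2]
      · have h0 : i = (o, i.2) := Prod.ext hi rfl
        simp [Qv₀, ← h0]
      · intro μ _ hμ
        have h0 : i ≠ (o, μ) := fun h => hμ (by rw [h])
        simp [Qv₀, h0]
      · simp
    · rw [if_neg hi]
      refine Finset.sum_eq_zero fun μ _ => ?_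
      have h0 : i ≠ (o, μ) := fun h => hi (by rw [h])
      simp [Qv₀, h0]
  · rw [if_neg hij]
    refine Finset.sum_eq_zero fun μ _ => ?_
    by_cases hi : i = (o, μ)
    · have hj : j ≠ (o, μ) := fun h => hij (hi.trans h.symm)
      simp [Qv₀, hj]
    · simp [Qv₀, hi]

omit [Fintype Λ] in
/-- closed form of the zero fiber of (1.73): `diag (Δ(l) + a·[l = 0])`. [folklore] -/
theorem Da₀_eq (o : Λ) (a : ℝ) (Δ : Λ → ℝ) :
    Da₀ (d := d) o a Δ
      = Matrix.diagonal (fun i => if i.1 = o then (Δ i.1 : ℂ) + a else (Δ i.1 : ℂ)) := by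
  rw [Da₀, Qv₀H_mul_Qv₀]
  ext i j
  simp only [Matrix.add_apply, Matrix.smul_apply, Matrix.diagonal_apply, smul_eq_mul]
  split_ifs <;> ring

/-- (1.73) ⟹ (1.83) at `p′ = 0`: `(Δ + aQ*Q) G₀ = 1`, i.e. `Ã_μ(l) = J̃_μ(l)/Δ(l)` (`l ≠ 0`) and
`Ã_μ(0) = a⁻¹J̃_μ(0)` ((1.74), (1.82), last line of (1.83)).
[cite: Balaban1984PropagatorsI, (1.74) p.30, (1.82)-(1.83) p.31 (proof ours)] -/
theorem Da₀_mul_G₀ (o : Λ) {a : ℝ} (ha : a ≠ 0) {Δ : Λ → ℝ} (hΔo : Δ o = 0)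
    (hΔ : ∀ l, l ≠ o → Δ l ≠ 0) : Da₀ (d := d) o a Δ * G₀ o a Δ = 1 := by
  have ha' : (a : ℂ) ≠ 0 := by exact_mod_cast ha
  rw [Da₀_eq, G₀, Matrix.diagonal_mul_diagonal, ← Matrix.diagonal_one]
  congr 1
  funext i
  by_cases hi : i.1 = o
  · rw [if_pos hi, if_pos hi, hi, hΔo]
    push_cast
    simp [ha']
  · rw [if_neg hi, if_neg hi]
    have h := hΔ i.1 hi
    have h' : (Δ i.1 : ℂ) ≠ 0 := by exact_mod_cast h
    field_simp

/-- and `G₀ (Δ + aQ*Q) = 1` at `p′ = 0`. [folklore] -/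
theorem G₀_mul_Da₀ (o : Λ) {a : ℝ} (ha : a ≠ 0) {Δ : Λ → ℝ} (hΔo : Δ o = 0)
    (hΔ : ∀ l, l ≠ o → Δ l ≠ 0) : G₀ o a Δ * Da₀ (d := d) o a Δ = 1 :=
  mul_eq_one_comm.mp (Da₀_mul_G₀ o ha hΔo hΔ)

end Zero

/-! ## §7 Bałaban's fibers: `T_η = (ℤ/n)^d`-blocks over the unit-lattice momenta -/

section Concrete

variable {d : ℕ} (n : ℕ) [NeZero n] (hn : 1 ≤ n) (a : ℝ) (ha : 0 < a) (s : Fin d → ℝ)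
  (hs : ∀ μ, |s μ| ≤ Real.pi) (hs0 : s ≠ 0)

/-- For Bałaban's symbols (1.31), (1.61) at a unit-lattice momentum `p′ = s ≠ 0` the hypothesis
`Δ(p′+l) = Σ_μ |∂_μ(p′+l)|²` is (1.31) itself, so `Δ_a(p′) G(p′) = 1` unconditionally.
[cite: Balaban1984PropagatorsI, (1.31) p.23, (1.73) p.30, (1.83) p.31 (proof ours)] -/
theorem Da_mul_G_balaban :
    Da (balabanFiber n hn a ha s hs hs0) * (balabanFiber n hn a ha s hs hs0).G = 1 :=
  Da_mul_G _ (fun k => Delta_eq n k s)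

/-- `G(p′) Δ_a(p′) = 1` for Bałaban's fibers, `p′ ≠ 0`. [folklore] -/
theorem G_mul_Da_balaban :
    (balabanFiber n hn a ha s hs hs0).G * Da (balabanFiber n hn a ha s hs hs0) = 1 :=
  G_mul_Da _ (fun k => Delta_eq n k s)

/-- `G(p′) = Δ_a(p′)⁻¹` (1.71) for Bałaban's fibers, `p′ ≠ 0`.
[cite: Balaban1984PropagatorsI, (1.71) p.30 (proof ours)] -/
theorem G_eq_inv_balaban :
    (balabanFiber n hn a ha s hs hs0).G = (Da (balabanFiber n hn a ha s hs hs0))⁻¹ :=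
  G_eq_inv _ (fun k => Delta_eq n k s)

end Concrete

/-! ## §8 Operator level: `𝒟_a 𝒢 = 1 = 𝒢 𝒟_a` on `ℓ²(T_η; ℂ^d)` -/

section Operator

variable {d : ℕ} (n : ℕ) [NeZero n] (hn : 1 ≤ n) (M : Fin d → ℕ) [hM : ∀ μ, NeZero (M μ)]
  (a : ℝ) (ha : 0 < a)

/-- the fiber matrices of `Δ_a` (1.73): `Da (balabanFiber …)` at `p′ ≠ 0` and `Da₀` at `p′ = 0`,
the companion of `B5Prop11Plancherel.blocks`. [cite: Balaban1984PropagatorsI, (1.73) p.30] -/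
def DaBlocks (q : Tor M) : Matrix ((Fin d → Fin n) × Fin d) ((Fin d → Fin n) × Fin d) ℂ :=
  if h : q = 0 then Da₀ (d := d) (fun _ => (0 : Fin n)) a (fun k => DeltaXir n 0 (shiftr n k 0))
  else Da (balabanFiber n hn a ha (sOf M q) (abs_sOf_le M q) (sOf_ne_zero M h))

/-- `𝒟̂_a`: the block family of (1.73) transported to (fine momentum, component) indices along the
coset decomposition `p = p′ + l` (same transport as `calGhat`). [folklore] -/
def calDahat : Matrix (Tor (fine n M) × Fin d) (Tor (fine n M) × Fin d) ℂ :=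
  (Matrix.reindex (blockEquiv n M) (blockEquiv n M)).symm
    (Matrix.blockDiagonal (DaBlocks n hn M a ha))

/-- `𝒟_a = F^* 𝒟̂_a F`: the operator on `ℓ²(T_η; ℂ^d)` whose Fourier blocks over the cosets are the
fibers of (1.73). [cite: Balaban1984PropagatorsI, (1.73) p.30] -/
def calDa : Matrix (Tor (fine n M) × Fin d) (Tor (fine n M) × Fin d) ℂ :=
  star (dftV (fine n M)) * calDahat n hn M a ha * dftV (fine n M)

/-- block by block: `Δ_a(p′) G(p′) = 1` for every coarse momentum `p′` (incl. `p′ = 0`). [folklore] -/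
theorem DaBlocks_mul_blocks (q : Tor M) : DaBlocks n hn M a ha q * blocks n hn M a ha q = 1 := by
  by_cases hq : q = 0
  · subst hq
    simp only [DaBlocks, blocks, dif_pos]
    refine Da₀_mul_G₀ _ ha.ne' (Delta_zero_zero n) ?_
    intro k hk
    have hs : ∀ μ, |(0 : Fin d → ℝ) μ| ≤ Real.pi := fun μ => by simp [Real.pi_pos.le]
    exact (lt_of_lt_of_le (by norm_num) (DeltaXir_shift_ge_four n k hk 0 hs)).ne'
  · simp only [DaBlocks, blocks, dif_neg hq]
    exact Da_mul_G _ (fun k => Delta_eq n k _)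

/-- in momentum space: `𝒟̂_a Ĝ = 1`. [folklore] -/
theorem calDahat_mul_calGhat : calDahat n hn M a ha * calGhat n hn M a ha = 1 := by
  rw [calDahat, calGhat, Matrix.reindex_symm, Matrix.reindex_apply, Matrix.reindex_apply,
    Equiv.symm_symm, Matrix.submatrix_mul_equiv, ← Matrix.blockDiagonal_mul]
  have h : (fun q => DaBlocks n hn M a ha q * blocks n hn M a ha q) = 1 :=
    funext fun q => DaBlocks_mul_blocks n hn M a ha q
  rw [h, Matrix.blockDiagonal_one, Matrix.submatrix_one_equiv]

/-- THE INVERSE, operator level: `𝒟_a 𝒢 = 1` on `ℓ²(T_η; ℂ^d)` — the operator `𝒢` of pass 4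
(`B5Prop11Plancherel.calG`, Fourier blocks (1.83)) is a right inverse of the operator whose Fourier
blocks are the fibers of (1.73). [cite: Balaban1984PropagatorsI, (1.71) p.30, (1.83) p.31 (proof ours)] -/
theorem calDa_mul_calG : calDa n hn M a ha * calG n hn M a ha = 1 := by
  rw [calDa, calG]
  have hU : dftV (fine n M) * star (dftV (fine n M)) = 1 := dftV_mul_star (fine n M)
  have hU' : star (dftV (fine n M)) * dftV (fine n M) = 1 := star_dftV_mul (fine n M)
  calc star (dftV (fine n M)) * calDahat n hn M a ha * dftV (fine n M)
        * (star (dftV (fine n M)) * calGhat n hn M a ha * dftV (fine n M))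
        = star (dftV (fine n M)) * (calDahat n hn M a ha * (dftV (fine n M) * star (dftV (fine n M)))
            * calGhat n hn M a ha) * dftV (fine n M) := by
          simp only [Matrix.mul_assoc]
    _ = 1 := by
          rw [hU, Matrix.mul_one, calDahat_mul_calGhat, Matrix.mul_one, hU']

/-- `𝒢 𝒟_a = 1`. [folklore] -/
theorem calG_mul_calDa : calG n hn M a ha * calDa n hn M a ha = 1 :=
  mul_eq_one_comm.mp (calDa_mul_calG n hn M a ha)

/-- `𝒢 = 𝒟_a⁻¹` (1.71) at operator level. [cite: Balaban1984PropagatorsI, (1.71) p.30 (proof ours)] -/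
theorem calG_eq_inv : calG n hn M a ha = (calDa n hn M a ha)⁻¹ :=
  (Matrix.inv_eq_right_inv (calDa_mul_calG n hn M a ha)).symm

/-- `𝒟_a` is Hermitian (as `𝒢` is, `B5Prop11Plancherel.calG_isHermitian`). [folklore] -/
theorem calDa_isHermitian : (calDa n hn M a ha).IsHermitian := by
  have h := calG_isHermitian n hn M a ha
  have e : calDa n hn M a ha = (calG n hn M a ha)⁻¹ :=
    (Matrix.inv_eq_right_inv (calG_mul_calDa n hn M a ha)).symm
  rw [e]
  exact h.inv

end Operator


end

end Literature.MathematicalPhysics.QuantumFieldTheory.Balaban1983to89.B5Prop11Inverse
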